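import Summits.KontsevichZagierPeriods.KontsevichZagierPeriods.Theorems.MzvKernelInKZ.Negative.ScalingDivision
import Summits.KontsevichZagierPeriods.KontsevichZagierPeriods.Theorems.VietaFibreKernelFormStubCubeMul
import Summits.KontsevichZagierPeriods.KontsevichZagierPeriods.Theorems.VietaFibreKernelFormStubRationalBox
import HarnessLib

/-!
# Crux `KernelForm` (stmt-KontsevichZagierPeriods-10447), line `Sketch`: algebraic cancellers cancel

The geometric half of the cut `KernelForm ↔ WeakKernel ∧ Cancellation` asks that every formal
combination `s` of non-zero value be a non-zero-divisor on the formal period ring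
`P = KZ.FormalRep ⧸ KZ.relations`.  This file proves the part of `Cancellation` that the calculus
gives for free, and thereby locates where the content of the registered stub
`stub_unitPlusSmallCancellation` begins.

* `scale_mul_sub_mem` — the scaling endomorphisms `KZ.scale a` (`[σ, f] ↦ [σ, a f]`, `a` real
  algebraic) are `P`-linear: `scale a x * c ≡ scale a (x * c)`.
* `mem_relations_of_scale_mem` — **ALGEBRAIC DIVISION is a derived rule**: for a non-zero real
  algebraic `a`, `scale a c ∈ relations → c ∈ relations` (the integer case is
  `MzvKernelInKZ.Negative.mem_relations_of_nsmul_mem`).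
* `cancellation_of_sub_scale_mem` — **every canceller whose class is a non-zero real algebraic
  number cancels**: if `s ≡ a · [U]` (`U` a unit cube, `a ≠ 0` algebraic) and `s * c ∈ relations`
  then `c ∈ relations`.  So the image of `(ℚ̄ ∩ ℝ)ˣ` in `P` consists of non-zero-divisors.
* `unitPlusSmallCancellation_of_algebraic`, `unitPlusSmallCancellation_of_rationalBox` — the thin
  cancellers `1 + [K]` of the stub cancel as soon as `[K]` is of algebraic class, e.g. for every
  rational box `K = [0, a/b] × [0,1]^k`.  Consequently the registered stub has no content for
  cancellers of algebraic class; its first honest instance is a thin canceller whose class is a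
  transcendental period (a small disc: `AyoubPiCancellation`, stmt-0540, see
  `piCancellation_of_cancellation` in `…CancellationDictionary.lean`).

References: M. Kontsevich, D. Zagier, *Periods* (2001), §1.1 ("rational" may be replaced by
"algebraic"), §1.2 (rules (1b), (2)), §4.1 (products).
-/

noncomputable section

open MeasureTheory Set
open Literature.NumberTheory.Transcendental

namespace Summit.KontsevichZagierPeriods.KernelForm.LocaliseAtValuePrime

open Summit.KontsevichZagierPeriods.MzvKernelInKZ.Negative (scale_scale_sub_mem scale_add_sub_mem
  scale_one_sub_mem scale_congr isAlgebraic_natCast scale_nat_sub_nsmul_mem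
  sub_mem_relations_of_forall_of mem_relations_of_nsmul_mem)

/-! ### `KZ.scale a` is linear over the formal period ring -/

/-- On generators: `[σ, a f] * [τ, g]` and `a · ([σ, f] * [τ, g])` have the same domain and the
same integrand, hence differ by a relation. [folklore] -/
theorem of_constMul_prod_sub_mem {n m : ℕ} (a : ℝ) (ha : IsAlgebraic ℚ a)
    (r : KZ.IntegralRep n) (s : KZ.IntegralRep m) :
    KZ.of ((r.constMul a ha).prod s) - KZ.of ((r.prod s).constMul a ha) ∈ KZ.relations := by
  refine KZ.of_sub_of_mem_relations_of_eqOn rfl fun z _ => ?_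
  simp only [KZ.IntegralRep.prod_integrand_eq, KZ.IntegralRep.prodFun_apply,
    KZ.IntegralRep.integrand_constMul, mul_assoc]

/-- **`scale a` is `P`-linear**: `scale a x * c − scale a (x * c) ∈ relations`. [folklore] -/
theorem scale_mul_sub_mem (a : ℝ) (ha : IsAlgebraic ℚ a) (x c : KZ.FormalRep) :
    KZ.scale a ha x * c - KZ.scale a ha (x * c) ∈ KZ.relations := by
  -- first for a generator `x = [r]`, by additivity in `c`
  have hgen : ∀ (n : ℕ) (r : KZ.IntegralRep n) (c : KZ.FormalRep),
      KZ.scale a ha (KZ.of r) * c - KZ.scale a ha (KZ.of r * c) ∈ KZ.relations := by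
    intro n r c
    have h := sub_mem_relations_of_forall_of (AddMonoidHom.mulLeft (KZ.scale a ha (KZ.of r)))
      ((KZ.scale a ha).comp (AddMonoidHom.mulLeft (KZ.of r))) (fun m s => ?_) c
    · simpa using h
    · simp only [AddMonoidHom.coe_mulLeft, AddMonoidHom.coe_comp, Function.comp_apply,
        KZ.scale_of, KZ.of_mul_of]
      exact of_constMul_prod_sub_mem a ha r s
  -- then additivity in `x`
  have h := sub_mem_relations_of_forall_of ((AddMonoidHom.mulRight c).comp (KZ.scale a ha))
    ((KZ.scale a ha).comp (AddMonoidHom.mulRight c)) (fun n r => ?_) x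
  · simpa using h
  · simpa using hgen n r c

/-! ### Algebraic division -/

/-- **ALGEBRAIC DIVISION is a derived rule of the calculus**: for a non-zero real algebraic `a`,
`scale a c ∈ relations → c ∈ relations` (`c ≡ scale 1 c = scale (a⁻¹ a) c ≡ scale a⁻¹ (scale a c)`,
and `scale` preserves relations). [folklore] -/
theorem mem_relations_of_scale_mem (a : ℝ) (ha : IsAlgebraic ℚ a) (h0 : a ≠ 0) (c : KZ.FormalRep)
    (h : KZ.scale a ha c ∈ KZ.relations) : c ∈ KZ.relations := by
  have hinv : IsAlgebraic ℚ a⁻¹ := ha.inv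
  have h1 := scale_one_sub_mem c
  have h2 := scale_scale_sub_mem a⁻¹ a hinv ha c
  have e : KZ.scale (a⁻¹ * a) (hinv.mul ha) c = KZ.scale 1 isAlgebraic_one c :=
    scale_congr _ _ (inv_mul_cancel₀ h0) c
  rw [e] at h2
  have h3 : KZ.scale a⁻¹ hinv (KZ.scale a ha c) ∈ KZ.relations := KZ.scale_mem_relations _ _ h
  have : c = -(KZ.scale 1 isAlgebraic_one c - c) -
      (KZ.scale a⁻¹ hinv (KZ.scale a ha c) - KZ.scale 1 isAlgebraic_one c) +
      KZ.scale a⁻¹ hinv (KZ.scale a ha c) := by abel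
  rw [this]
  exact add_mem (sub_mem (neg_mem h1) h2) h3

/-! ### Cancellers of algebraic class cancel -/

/-- **Every canceller whose class is a non-zero real algebraic number cancels**: if
`s ≡ a · [U]` with `U = [[0,1]^m, 1]` a unit cube and `a ≠ 0` real algebraic, then
`s * c ∈ relations → c ∈ relations`.  (`a · [U] * c ≡ a · ([U] * c) ≡ a · c`, then algebraic
division.) [folklore] -/
theorem cancellation_of_sub_scale_mem :
    ∀ (a : ℝ) (ha : IsAlgebraic ℚ a), a ≠ 0 → ∀ (m : ℕ) (U : KZ.IntegralRep m),
      U.domain = KZ.cube m → (U.integrand = fun _ => 1) → ∀ c s : KZ.FormalRep,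
      s - KZ.scale a ha (KZ.of U) ∈ KZ.relations → s * c ∈ KZ.relations → c ∈ KZ.relations := by
  intro a ha h0 m U hUd hUi c s hs hsc
  -- `a·[U] * c ∈ relations`
  have h1 : KZ.scale a ha (KZ.of U) * c ∈ KZ.relations := by
    have h := KZ.mul_mem_relations_right_holds _ c hs
    rw [sub_mul] at h
    have : KZ.scale a ha (KZ.of U) * c = s * c - (s * c - KZ.scale a ha (KZ.of U) * c) := by abel
    rw [this]
    exact sub_mem hsc h
  -- `a·([U] * c) ∈ relations`
  have h2 : KZ.scale a ha (KZ.of U * c) ∈ KZ.relations := by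
    have h := scale_mul_sub_mem a ha (KZ.of U) c
    have : KZ.scale a ha (KZ.of U * c) =
        KZ.scale a ha (KZ.of U) * c - (KZ.scale a ha (KZ.of U) * c - KZ.scale a ha (KZ.of U * c)) := by
      abel
    rw [this]
    exact sub_mem h1 h
  -- `[U] * c ∈ relations`, and `[U] * c ≡ c`
  have h3 : KZ.of U * c ∈ KZ.relations := mem_relations_of_scale_mem a ha h0 _ h2
  have h4 : KZ.of U * c - c ∈ KZ.relations := by
    have e : KZ.of U * c - c = (KZ.of U * c - c * KZ.of U) + (c * KZ.of U - c) := by abel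
    rw [e]
    exact add_mem (KZ.mul_sub_mul_comm_mem_relations _ _) (stub_cubeMul m U c hUd hUi)
  have : c = KZ.of U * c - (KZ.of U * c - c) := by abel
  rw [this]
  exact sub_mem h3 h4

/-- **Thin cancellers of algebraic class cancel**: if `[K] ≡ a · [U]` (`a ≥ 0` real algebraic,
`U` the unit cube of the same dimension) and `c + [K] * c ∈ relations`, then `c ∈ relations` — the
canceller `[U] + [K] ≡ (1 + a) · [U]` has non-zero algebraic class.  Hence the registered stub
`stub_unitPlusSmallCancellation` has no content for cancellers of algebraic class. [folklore] -/
theorem unitPlusSmallCancellation_of_algebraic :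
    ∀ (c : KZ.FormalRep) (k : ℕ) (K U : KZ.IntegralRep (k + 1)) (a : ℝ) (ha : IsAlgebraic ℚ a),
      0 ≤ a → U.domain = KZ.cube (k + 1) → (U.integrand = fun _ => 1) →
      KZ.of K - KZ.scale a ha (KZ.of U) ∈ KZ.relations → c + KZ.of K * c ∈ KZ.relations →
      c ∈ KZ.relations := by
  intro c k K U a ha ha0 hUd hUi hK hcK
  have h1a : IsAlgebraic ℚ (1 + a) := isAlgebraic_one.add ha
  refine cancellation_of_sub_scale_mem (1 + a) h1a (by positivity) (k + 1) U hUd hUi c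
    (KZ.of U + KZ.of K) ?_ ?_
  · -- `[U] + [K] ≡ scale 1 [U] + scale a [U] ≡ scale (1 + a) [U]`
    have e1 := scale_one_sub_mem (KZ.of U)
    have e2 := scale_add_sub_mem 1 a isAlgebraic_one ha (KZ.of U)
    have e3 : KZ.scale (1 + a) (isAlgebraic_one.add ha) (KZ.of U) = KZ.scale (1 + a) h1a (KZ.of U) :=
      scale_congr _ _ rfl _
    rw [e3] at e2
    have : KZ.of U + KZ.of K - KZ.scale (1 + a) h1a (KZ.of U) =
        -(KZ.scale 1 isAlgebraic_one (KZ.of U) - KZ.of U) + (KZ.of K - KZ.scale a ha (KZ.of U)) -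
          (KZ.scale (1 + a) h1a (KZ.of U) -
            (KZ.scale 1 isAlgebraic_one (KZ.of U) + KZ.scale a ha (KZ.of U))) := by abel
    rw [this]
    exact sub_mem (add_mem (neg_mem e1) hK) e2
  · -- `([U] + [K]) * c = ([U] * c - c) + (c + [K] * c)`
    have hU1 : KZ.of U * c - c ∈ KZ.relations := by
      have e : KZ.of U * c - c = (KZ.of U * c - c * KZ.of U) + (c * KZ.of U - c) := by abel
      rw [e]
      exact add_mem (KZ.mul_sub_mul_comm_mem_relations _ _) (stub_cubeMul (k + 1) U c hUd hUi)
    have e : (KZ.of U + KZ.of K) * c = (KZ.of U * c - c) + (c + KZ.of K * c) := by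
      rw [add_mul]; abel
    rw [e]
    exact add_mem hU1 hcK

/-- A rational box `[[0, a/b] × [0,1]^k, 1]` is of algebraic (indeed rational) class:
`[R] ≡ (a/b) · [U]` (from `stub_rationalBox`: `b • [R] ≡ a • [U]`, the arithmetic of `scale`, and
integer division). [folklore] -/
theorem of_rationalBox_sub_scale_mem (k a b : ℕ) (R U : KZ.IntegralRep (k + 1)) (ha : 0 < a)
    (hb : 0 < b) (hRd : R.domain = {x | (0 ≤ x 0 ∧ x 0 ≤ (a : ℝ) / b) ∧ ∀ i, i ≠ 0 → 0 ≤ x i ∧ x i ≤ 1})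
    (hRi : R.integrand = fun _ => 1) (hUd : U.domain = KZ.cube (k + 1))
    (hUi : U.integrand = fun _ => 1) (hab : IsAlgebraic ℚ ((a : ℝ) / b)) :
    KZ.of R - KZ.scale ((a : ℝ) / b) hab (KZ.of U) ∈ KZ.relations := by
  have hRU : b • KZ.of R - a • KZ.of U ∈ KZ.relations := stub_rationalBox k a b R U ha hb hRd hRi hUd hUi
  have hb0 : (b : ℝ) ≠ 0 := by exact_mod_cast hb.ne'
  -- `scale b ([R] − (a/b)·[U]) ≡ b•[R] − a•[U] ≡ 0`
  refine mem_relations_of_scale_mem (b : ℝ) (isAlgebraic_natCast b) hb0 _ ?_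
  rw [map_sub]
  have e1 := scale_nat_sub_nsmul_mem b (KZ.of R)
  have e2 := scale_nat_sub_nsmul_mem a (KZ.of U)
  have e3 := scale_scale_sub_mem (b : ℝ) ((a : ℝ) / b) (isAlgebraic_natCast b) hab (KZ.of U)
  have e4 : KZ.scale ((b : ℝ) * ((a : ℝ) / b)) ((isAlgebraic_natCast b).mul hab) (KZ.of U) =
      KZ.scale (a : ℝ) (isAlgebraic_natCast a) (KZ.of U) :=
    scale_congr _ _ (mul_div_cancel₀ _ hb0) _
  rw [e4] at e3
  have : KZ.scale (b : ℝ) (isAlgebraic_natCast b) (KZ.of R) -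
      KZ.scale (b : ℝ) (isAlgebraic_natCast b) (KZ.scale ((a : ℝ) / b) hab (KZ.of U)) =
      (KZ.scale (b : ℝ) (isAlgebraic_natCast b) (KZ.of R) - b • KZ.of R) + (b • KZ.of R - a • KZ.of U) -
        (KZ.scale (a : ℝ) (isAlgebraic_natCast a) (KZ.of U) - a • KZ.of U) -
        (KZ.scale (b : ℝ) (isAlgebraic_natCast b) (KZ.scale ((a : ℝ) / b) hab (KZ.of U)) -
          KZ.scale (a : ℝ) (isAlgebraic_natCast a) (KZ.of U)) := by abel
  rw [this]
  exact sub_mem (sub_mem (add_mem e1 hRU) e2) e3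

/-- **Thin cancellers that are rational boxes cancel**: for `R = [[0, a/b] × [0,1]^k, 1]`,
`c + [R] * c ∈ relations → c ∈ relations`. [folklore] -/
theorem unitPlusSmallCancellation_of_rationalBox :
    ∀ (c : KZ.FormalRep) (k a b : ℕ) (R : KZ.IntegralRep (k + 1)), 0 < a → 0 < b →
      R.domain = {x | (0 ≤ x 0 ∧ x 0 ≤ (a : ℝ) / b) ∧ ∀ i, i ≠ 0 → 0 ≤ x i ∧ x i ≤ 1} →
      (R.integrand = fun _ => 1) → c + KZ.of R * c ∈ KZ.relations → c ∈ KZ.relations := by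
  intro c k a b R ha hb hRd hRi hcR
  obtain ⟨U, hUd, hUi⟩ := KZ.exists_oneRep (KZ.isSemialgebraic_cube (n := k + 1))
    (by simp [KZ.volume_cube])
  have hab : IsAlgebraic ℚ ((a : ℝ) / b) := by
    have : ((((a : ℚ) / b : ℚ)) : ℝ) = (a : ℝ) / b := by push_cast; rfl
    rw [← this]; exact isAlgebraic_algebraMap _
  exact unitPlusSmallCancellation_of_algebraic c k R U ((a : ℝ) / b) hab (by positivity) hUd hUi
    (of_rationalBox_sub_scale_mem k a b R U ha hb hRd hRi hUd hUi hab) hcR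

end Summit.KontsevichZagierPeriods.KernelForm.LocaliseAtValuePrime
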